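import Literature.AnabelianGeometry.EtaleTheta.BiKummerThm44Sub

/-!
# [EtTh] Theorem 4.4 (i)/(iii): descent of `Ψ^bs`'s isomorphism `Π^tp_{X₁} ⥲ Π^tp_{X₂}` to `G_{K₁} ⥲ G_{K₂}` and
# transport of `H_⊙^{bs-fld}` — the Galois-side fields of the [FrdII] Def 2.2 context isomorphism (proof-only)

S. Mochizuki, *The étale theta function and its Frobenioid-theoretic manifestations*, Publ. RIMS **45** (2009)
[MochizukiEtTh2009], §4, Thm 4.4 (i) PDF p.94 («`Ψ^bs` induces an isomorphism `H_{⊙,1} ⥲ H_{⊙,2}`, … well-defined up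
to composition with inner automorphisms of `Π^tp_{X_i}`»), proof p.95 ll.5–6 («the theory of [quasi-]temperoids
[cf. [SemiAnbd], Proposition 3.2; Theorem A.4]») and ll.14–16 («the "manifestly category-theoretic nature" of
"`(N, H^{bs-fld}_{⊙,i})`-saturation" — cf. [FrdII], Definition 2.2, (ii); [AbsAnab], Lemma 1.3.8»); Def 4.1 p.86
(«`H_⊙^{bs-fld} ⊆ G_K` … the image of `H_⊙` in `G_K`»).  S. Mochizuki, *The absolute anabelian geometry of canonical
curves* [MochizukiAbsAnab2004], Lemma 1.3.8 p.18 (an isomorphism `Π₁ ⥲ Π₂` carries `Δ₁` onto `Δ₂`, hence induces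
`G_{K₁} ⥲ G_{K₂}`).

abc-iut cell, layer L2, plan/L2/SUBDAG-EtTh-Thm44.md row **T44-L15b at the faithful [FrdII] Def 2.2 (ii) reading**
(seat abc-iut-w6-d047 gen 2, GO abc-iut-L2-lead 08:39:46Z R199), file 2.  File 1 (`BiKummerThm44SubNHSatDef22.lean`)
reduced T44-L15b to «`Ψ` induces a `PadicKummer.Def22Context.Iso` of the Def 2.2 contexts of `A''` and
`B'' ≅ Ψ(A'')`»; such an isomorphism carries, among its fields, a topological isomorphism `isoG : G₁ ⥲ G₂` of the
base Galois groups with `map_H : isoG(H₁) = H₂`.  In the [EtTh] §4 setting `G_i = G_{K_i}`, `H_i = H^{bs-fld}_{⊙,i}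
= aug_i(H_{⊙,i})`, and print obtains `isoG` by DESCENDING the isomorphism `θ : Π^tp_{X₁} ⥲ Π^tp_{X₂}` of T44-L09
(`Thm44Hyp.HodotCompatible`) along the augmentations, using [AbsAnab] Lem 1.3.8 (`θ(Δ₁) = Δ₂`; the tree's named
fact F-0007 `FundamentalExtension.PreservesGeom`, here an explicit HYPOTHESIS `hΔ` at the tempered groups, as in
abc-iut-w4-d014's `Discharge/Sec1AutPreservesDeltaTemp.lean`).  This PROOF-ONLY file (0 `def`s, no `Prop` fact, no
instance) kernel-checks that descent over abc-iut-L3's interface `SemiGraphs.TemperedArithmeticGroup`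
(`aug : Π^tp_X →ₜ* G_K` surjective, `delta = Ker aug`) and abc-iut-L2-t3's `BiKummerSetting.Hodot` / `HodotBsFld`:
* `TemperedArithmeticGroup.exists_galoisEquiv_of_map_delta` — `θ : Π₁ ≃* Π₂` with `θ(Δ₁) = Δ₂` descends to a UNIQUE
  (`galoisEquiv_unique_of_over`) `ι : G_{K₁} ≃* G_{K₂}` over `θ` (`ι ∘ aug₁ = aug₂ ∘ θ`);
* `…map_aug_map_of_over` — any `ι` over `θ` carries `aug₁(H)` to `aug₂(θ H)` for every `H ⊆ Π₁`;
* `…continuous_of_over` / `exists_galoisContinuousEquiv_of_map_delta` — bicontinuity of `ι` when the augmentations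
  are OPEN maps (binder `haug : IsOpenMap X.aug`, the tree's standing hypothesis of
  `TemperedArithmeticGroupOfOpenSubgroupOpenAug` / `ArithTemperedGroupTopology`: «`Π^tp_X ↠ G_K` is open»);
* `BiKummerSetting.hodotBsFld_normal` / `isOpen_hodotBsFld_of_isOpenMap` — `H_⊙^{bs-fld} ⊆ G_K` is normal, and open
  when `H_⊙` is open and `aug` is an open map (the `[H.Normal]` / `isOpen_H` fields of a Def 2.2 context at
  `H := H_⊙^{bs-fld}`);
* `BiKummerSetting.map_hodotBsFld_of_over` — if `θ(H_{⊙,1}) = H_{⊙,2}` (T44-L09) and `ι` lies over `θ`, then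
  `ι(H^{bs-fld}_{⊙,1}) = H^{bs-fld}_{⊙,2}` (the `map_H` field);
* `BiKummerSetting.exists_galoisContinuousEquiv_map_hodotBsFld` — the package: from `θ : Π^tp_{X₁} ≃ₜ* Π^tp_{X₂}`
  with `θ(H_{⊙,1}) = H_{⊙,2}` and `θ(Δ₁) = Δ₂`, and open augmentations, a topological `ι : G_{K₁} ≃ₜ* G_{K₂}` over
  `θ` with `ι(H^{bs-fld}_{⊙,1}) = H^{bs-fld}_{⊙,2}` — the Galois-side half (`isoG`, `map_H`) of the context
  isomorphism T44-L15b consumes at the faithful reading; the remaining half (`isoE`, `res_isoC`, `outer_isoG`,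
  `isoO_smul`) waits on the base-field functor `D → E = B(G_K)` of the v-next interface (census B2).
HONEST FRAMING: refereed pre-IUT material; elementary group theory/topology over the tree's interfaces with the
[AbsAnab] Lem 1.3.8 clause as a hypothesis; nothing here bears on [IUTchIII] Cor. 3.12; typed ≠ proved.
-/

noncomputable section

/-! ## Descent along the augmentations `Π^tp_{X_i} ↠ G_{K_i}` -/

namespace Literature.AnabelianGeometry.SemiGraphs

namespace TemperedArithmeticGroup

universe u

variable {K₁ : Type u} [Field K₁] {K₂ : Type u} [Field K₂] (X₁ : TemperedArithmeticGroup.{u} K₁)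
  (X₂ : TemperedArithmeticGroup.{u} K₂)

/-- **[AbsAnab] Lem 1.3.8, descent clause, over the tempered interface**: an isomorphism `θ : Π^tp_{X₁} ⥲ Π^tp_{X₂}`
carrying `Δ₁ = Ker(aug₁)` onto `Δ₂` induces an isomorphism `ι : G_{K₁} ⥲ G_{K₂}` of abstract groups lying over it,
`ι (aug₁ g) = aug₂ (θ g)` (through `Π_i/Δ_i ≅ G_{K_i}`, `quotientDeltaEquiv`). [cite: MochizukiAbsAnab2004, Lemma 1.3.8 p.18] -/
theorem exists_galoisEquiv_of_map_delta (θ : X₁.Pi ≃* X₂.Pi) (hΔ : X₁.delta.map θ.toMonoidHom = X₂.delta) :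
    ∃ ι : Field.absoluteGaloisGroup K₁ ≃* Field.absoluteGaloisGroup K₂, ∀ g : X₁.Pi, ι (X₁.aug g) = X₂.aug (θ g) := by
  refine ⟨X₁.quotientDeltaEquiv.symm.trans ((QuotientGroup.congr X₁.delta X₂.delta θ hΔ).trans X₂.quotientDeltaEquiv),
    fun g => ?_⟩
  have h1 : X₁.quotientDeltaEquiv.symm (X₁.aug g) = QuotientGroup.mk g := by
    rw [MulEquiv.symm_apply_eq]
    rfl
  rw [MulEquiv.trans_apply, MulEquiv.trans_apply, h1]
  rfl

/-- An isomorphism `G_{K₁} ⥲ G_{K₂}` over `θ` is unique (`aug₁` is surjective): «well-defined».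
[cite: MochizukiAbsAnab2004, Lemma 1.3.8 p.18] -/
theorem galoisEquiv_unique_of_over (θ : X₁.Pi ≃* X₂.Pi)
    {ι ι' : Field.absoluteGaloisGroup K₁ ≃* Field.absoluteGaloisGroup K₂}
    (hι : ∀ g : X₁.Pi, ι (X₁.aug g) = X₂.aug (θ g)) (hι' : ∀ g : X₁.Pi, ι' (X₁.aug g) = X₂.aug (θ g)) : ι = ι' := by
  apply MulEquiv.ext
  intro σ
  obtain ⟨g, rfl⟩ := X₁.aug_surjective σ
  rw [hι, hι']

/-- An isomorphism `ι : G_{K₁} ⥲ G_{K₂}` over `θ` carries the image `aug₁(H)` of any `H ⊆ Π^tp_{X₁}` to `aug₂(θ H)`.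
[cite: MochizukiEtTh2009, Def 4.1 p.86] -/
theorem map_aug_map_of_over (θ : X₁.Pi ≃* X₂.Pi) (ι : Field.absoluteGaloisGroup K₁ ≃* Field.absoluteGaloisGroup K₂)
    (hι : ∀ g : X₁.Pi, ι (X₁.aug g) = X₂.aug (θ g)) (H : Subgroup X₁.Pi) :
    (H.map X₁.aug.toMonoidHom).map ι.toMonoidHom = (H.map θ.toMonoidHom).map X₂.aug.toMonoidHom := by
  apply le_antisymm
  · rintro _ ⟨_, ⟨g, hg, rfl⟩, rfl⟩
    exact ⟨θ g, ⟨g, hg, rfl⟩, (hι g).symm⟩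
  · rintro _ ⟨_, ⟨g, hg, rfl⟩, rfl⟩
    exact ⟨X₁.aug g, ⟨g, hg, rfl⟩, hι g⟩

/-- The inverse of an isomorphism over `θ` lies over `θ⁻¹`. [cite: MochizukiAbsAnab2004, Lemma 1.3.8 p.18] -/
theorem symm_over_of_over (θ : X₁.Pi ≃* X₂.Pi) (ι : Field.absoluteGaloisGroup K₁ ≃* Field.absoluteGaloisGroup K₂)
    (hι : ∀ g : X₁.Pi, ι (X₁.aug g) = X₂.aug (θ g)) (g : X₂.Pi) : ι.symm (X₂.aug g) = X₁.aug (θ.symm g) := by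
  rw [MulEquiv.symm_apply_eq, hι, MulEquiv.apply_symm_apply]

/-- **Continuity of the descended isomorphism**: if `θ` is continuous and `aug₁ : Π^tp_{X₁} ↠ G_{K₁}` is an OPEN map
(binder `haug₁`), any `ι : G_{K₁} ⥲ G_{K₂}` over `θ` is continuous (`aug₁` is then a quotient map and
`ι ∘ aug₁ = aug₂ ∘ θ`). [cite: MochizukiAbsAnab2004, Lemma 1.3.8 p.18] -/
theorem continuous_of_over (θ : X₁.Pi ≃* X₂.Pi) (hθ : Continuous θ) (haug₁ : IsOpenMap X₁.aug)
    (ι : Field.absoluteGaloisGroup K₁ ≃* Field.absoluteGaloisGroup K₂)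
    (hι : ∀ g : X₁.Pi, ι (X₁.aug g) = X₂.aug (θ g)) : Continuous ι := by
  have hq : Topology.IsQuotientMap X₁.aug := haug₁.isQuotientMap (map_continuous X₁.aug) X₁.aug_surjective
  have hcomp : (ι : Field.absoluteGaloisGroup K₁ → Field.absoluteGaloisGroup K₂) ∘ X₁.aug = X₂.aug ∘ θ :=
    funext fun g => hι g
  rw [hq.continuous_iff, hcomp]
  exact (map_continuous X₂.aug).comp hθ

/-- **[AbsAnab] Lem 1.3.8, descent clause, topological form over the tempered interface**: a bicontinuous
`θ : Π^tp_{X₁} ⥲ Π^tp_{X₂}` with `θ(Δ₁) = Δ₂` induces, when both augmentations are open maps, a bicontinuous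
`ι : G_{K₁} ⥲ G_{K₂}` over it («`α` induces isomorphisms `Δ₁ ≅ Δ₂`, `G₁ ≅ G₂`»).
[cite: MochizukiAbsAnab2004, Lemma 1.3.8 p.18] -/
theorem exists_galoisContinuousEquiv_of_map_delta (θ : X₁.Pi ≃ₜ* X₂.Pi)
    (hΔ : X₁.delta.map θ.toMulEquiv.toMonoidHom = X₂.delta) (haug₁ : IsOpenMap X₁.aug) (haug₂ : IsOpenMap X₂.aug) :
    ∃ ι : Field.absoluteGaloisGroup K₁ ≃ₜ* Field.absoluteGaloisGroup K₂, ∀ g : X₁.Pi, ι (X₁.aug g) = X₂.aug (θ g) := by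
  obtain ⟨ι, hι⟩ := exists_galoisEquiv_of_map_delta X₁ X₂ θ.toMulEquiv hΔ
  have hc : Continuous ι := continuous_of_over X₁ X₂ θ.toMulEquiv (map_continuous θ) haug₁ ι hι
  have hc' : Continuous ι.symm :=
    continuous_of_over X₂ X₁ θ.toMulEquiv.symm (map_continuous θ.symm) haug₂ ι.symm
      (symm_over_of_over X₁ X₂ θ.toMulEquiv ι hι)
  exact ⟨{ ι with continuous_toFun := hc, continuous_invFun := hc' }, hι⟩

end TemperedArithmeticGroup

end Literature.AnabelianGeometry.SemiGraphs

/-! ## `H_⊙^{bs-fld} ⊆ G_K` (Def 4.1): normal, open, transported -/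

namespace Literature.AnabelianGeometry.EtaleTheta

open CategoryTheory Literature.AlgebraicGeometry.Frobenioids Literature.AnabelianGeometry.SemiGraphs

namespace BiKummerSetting

universe u₀ v₀ u v w

variable {K : Type u₀} [Field K] {K' : Type u₀} [Field K'] {D₀ : Type u₀} [Category.{v₀} D₀]
  {V : FrdIMonoidStub.{w}}
  {X₁ : SemiGraphs.TemperedArithmeticGroup.{u₀} K} {X₂ : SemiGraphs.TemperedArithmeticGroup.{u₀} K'}
  {D₀' : Type u₀} [Category.{v₀} D₀']
  {T₁ : RealifiedDivisorMonoids (D₀ := D₀) V} {T₂ : RealifiedDivisorMonoids (D₀ := D₀') V}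
  {D₁ D₂ : Type u} [Category.{v} D₁] [Category.{v} D₂] {VD₁ : FrdICatStub.{u, v, w} D₁}
  {VD₂ : FrdICatStub.{u, v, w} D₂} (S₁ : BiKummerSetting X₁ T₁ D₁ VD₁) (S₂ : BiKummerSetting X₂ T₂ D₂ VD₂)

/-- `H_⊙ ⊆ Π^tp_X` is normal (it is the kernel of `Π^tp_X ↠ Aut_D(A_⊙^bs)`, Def 4.1 p.86: «`A_⊙^bs` … Galois, hence
determines normal open subgroups `H_⊙ ⊆ Π^tp_X`»). [cite: MochizukiEtTh2009, Def 4.1 p.86] -/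
theorem hodot_normal : S₁.Hodot.Normal := by
  unfold Hodot
  infer_instance

/-- **`H_⊙^{bs-fld} ⊆ G_K` is normal** («`H_⊙^{bs-fld} ⊆ G_K`» is the image of the normal `H_⊙` under the SURJECTIVE
augmentation; the `[H.Normal]` field of a [FrdII] Def 2.2 context at `H := H_⊙^{bs-fld}`).
[cite: MochizukiEtTh2009, Def 4.1 p.86] -/
theorem hodotBsFld_normal : S₁.HodotBsFld.Normal := by
  haveI := S₁.hodot_normal
  exact Subgroup.Normal.map inferInstance X₁.aug.toMonoidHom X₁.aug_surjective

/-- **`H_⊙^{bs-fld} ⊆ G_K` is open** when `H_⊙` is open (a `Thm44Hyp` field) and `aug : Π^tp_X ↠ G_K` is an open map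
(binder `haug`) — the `isOpen_H` field of a [FrdII] Def 2.2 context at `H := H_⊙^{bs-fld}`.
[cite: MochizukiEtTh2009, Def 4.1 p.86] -/
theorem isOpen_hodotBsFld_of_isOpenMap (hH : IsOpen (S₁.Hodot : Set X₁.Pi)) (haug : IsOpenMap X₁.aug) :
    IsOpen (S₁.HodotBsFld : Set (Field.absoluteGaloisGroup K)) := by
  have e : (S₁.HodotBsFld : Set (Field.absoluteGaloisGroup K)) = X₁.aug '' (S₁.Hodot : Set X₁.Pi) := by
    ext σ
    constructor
    · rintro ⟨g, hg, rfl⟩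
      exact ⟨g, hg, rfl⟩
    · rintro ⟨g, hg, rfl⟩
      exact ⟨g, hg, rfl⟩
  rw [e]
  exact haug _ hH

/-- **Transport of `H_⊙^{bs-fld}`** (the `map_H` field of the [FrdII] Def 2.2 context isomorphism): if
`θ : Π^tp_{X₁} ⥲ Π^tp_{X₂}` carries `H_{⊙,1}` onto `H_{⊙,2}` (T44-L09, «`Ψ^bs` induces `H_{⊙,1} ⥲ H_{⊙,2}`») and
`ι : G_{K₁} ⥲ G_{K₂}` lies over `θ`, then `ι(H^{bs-fld}_{⊙,1}) = H^{bs-fld}_{⊙,2}`. [cite: MochizukiEtTh2009, Thm 4.4 (i) p.94] -/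
theorem map_hodotBsFld_of_over (θ : X₁.Pi ≃* X₂.Pi) (hH : S₁.Hodot.map θ.toMonoidHom = S₂.Hodot)
    (ι : Field.absoluteGaloisGroup K ≃* Field.absoluteGaloisGroup K') (hι : ∀ g : X₁.Pi, ι (X₁.aug g) = X₂.aug (θ g)) :
    S₁.HodotBsFld.map ι.toMonoidHom = S₂.HodotBsFld := by
  unfold HodotBsFld
  rw [TemperedArithmeticGroup.map_aug_map_of_over X₁ X₂ θ ι hι, hH]

/-- **The Galois-side half of the [FrdII] Def 2.2 context isomorphism that T44-L15b consumes at the faithful reading**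
(`isoG`, `map_H`; cf. `BiKummerThm44SubNHSatDef22.lean`): from the isomorphism `θ : Π^tp_{X₁} ⥲ Π^tp_{X₂}` of T44-L09
(`θ(H_{⊙,1}) = H_{⊙,2}`, [SemiAnbd] Prop 3.2) that moreover carries `Δ₁` onto `Δ₂` ([AbsAnab] Lem 1.3.8 — HYPOTHESIS
`hΔ`, the tree's F-0007 at the tempered groups) and open augmentations (`haug₁`, `haug₂`), a topological isomorphism
`ι : G_{K₁} ⥲ G_{K₂}` over `θ` carrying `H^{bs-fld}_{⊙,1}` onto `H^{bs-fld}_{⊙,2}`. [cite: MochizukiEtTh2009, Thm 4.4 p.95] -/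
theorem exists_galoisContinuousEquiv_map_hodotBsFld (θ : X₁.Pi ≃ₜ* X₂.Pi)
    (hH : S₁.Hodot.map θ.toMulEquiv.toMonoidHom = S₂.Hodot) (hΔ : X₁.delta.map θ.toMulEquiv.toMonoidHom = X₂.delta)
    (haug₁ : IsOpenMap X₁.aug) (haug₂ : IsOpenMap X₂.aug) :
    ∃ ι : Field.absoluteGaloisGroup K ≃ₜ* Field.absoluteGaloisGroup K',
      (∀ g : X₁.Pi, ι (X₁.aug g) = X₂.aug (θ g)) ∧ S₁.HodotBsFld.map ι.toMulEquiv.toMonoidHom = S₂.HodotBsFld := by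
  obtain ⟨ι, hι⟩ := TemperedArithmeticGroup.exists_galoisContinuousEquiv_of_map_delta X₁ X₂ θ hΔ haug₁ haug₂
  exact ⟨ι, hι, map_hodotBsFld_of_over S₁ S₂ θ.toMulEquiv hH ι.toMulEquiv hι⟩

/-- **The same, read from `Thm44Hyp` data**: with T44-L09 `HodotCompatible` supplied TOGETHER WITH the [AbsAnab]
Lem 1.3.8 clause for the same `θ` (the form the faithful T44-L15b needs — `HodotCompatible` alone records only
`θ(H_{⊙,1}) = H_{⊙,2}`), `Ψ^bs`'s isomorphism descends to `G_{K₁} ⥲ G_{K₂}` carrying `H^{bs-fld}_{⊙,1}` onto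
`H^{bs-fld}_{⊙,2}`; `H^{bs-fld}_{⊙,i}` are normal open subgroups (the Def 2.2 context data at `H := H_⊙^{bs-fld}`).
[cite: MochizukiEtTh2009, Thm 4.4 p.95] -/
theorem Thm44Hyp.hodotBsFld_def22Data_of_hodotDeltaCompatible {S₁ : BiKummerSetting X₁ T₁ D₁ VD₁}
    {S₂ : BiKummerSetting X₂ T₂ D₂ VD₂} (h : Thm44Hyp S₁ S₂)
    (h9Δ : ∃ θ : X₁.Pi ≃ₜ* X₂.Pi, S₁.Hodot.map θ.toMulEquiv.toMonoidHom = S₂.Hodot ∧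
      X₁.delta.map θ.toMulEquiv.toMonoidHom = X₂.delta)
    (haug₁ : IsOpenMap X₁.aug) (haug₂ : IsOpenMap X₂.aug) :
    S₁.HodotBsFld.Normal ∧ S₂.HodotBsFld.Normal ∧
      IsOpen (S₁.HodotBsFld : Set (Field.absoluteGaloisGroup K)) ∧
      IsOpen (S₂.HodotBsFld : Set (Field.absoluteGaloisGroup K')) ∧
      ∃ ι : Field.absoluteGaloisGroup K ≃ₜ* Field.absoluteGaloisGroup K',
        S₁.HodotBsFld.map ι.toMulEquiv.toMonoidHom = S₂.HodotBsFld := by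
  obtain ⟨θ, hH, hΔ⟩ := h9Δ
  obtain ⟨ι, -, hι⟩ := BiKummerSetting.exists_galoisContinuousEquiv_map_hodotBsFld S₁ S₂ θ hH hΔ haug₁ haug₂
  exact ⟨S₁.hodotBsFld_normal, S₂.hodotBsFld_normal, S₁.isOpen_hodotBsFld_of_isOpenMap h.isOpen_Hodot₁ haug₁,
    S₂.isOpen_hodotBsFld_of_isOpenMap h.isOpen_Hodot₂ haug₂, ι, hι⟩

end BiKummerSetting

end Literature.AnabelianGeometry.EtaleTheta

end
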